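import Summits.Schanuel.Schanuel.Theses.RigidCore
import Literature.NumberTheory.Transcendental.CuspValueAlgebraicCoeff
import Literature.NumberTheory.Transcendental.TaylorCoeffsAlgebraicOfRelation
import Literature.NumberTheory.Transcendental.LogTaylorCoeffsAlgebraic

/-!
# `stub_taylorLogCoeffsAlgebraic` (ANF) for the line `cusp-germ-schneider-sparsity` of crux `RigidCore.SparsityTwo`

WHAT. The arithmetic normal form of a cusp of a `ℚ`-curve (item stmt-Schanuel-0971): (1) if `Φ`
is analytic at `0` and `R(t⁻ᵉ, Φ(t)/tᴺ) = 0` on a punctured neighbourhood of `0` for a nonzero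
`R ∈ ℂ[X, Y]` with ALGEBRAIC coefficients (`e ≥ 1`), then every Taylor coefficient `Φ⁽ⁿ⁾(0)` is
algebraic over `ℚ`; (2) if `ℓ` is analytic at `0` and the unit `e^{ℓ}` satisfies such a relation,
then `e^{ℓ(0)}` is algebraic and so are the `ℓ⁽ⁿ⁾(0)`, `n ≥ 1`.

SOURCE / DESIGN. All mathematics lives in `Literature/NumberTheory/Transcendental/`:
`TaylorCoeffsAlgebraicOfRelation` proves (1) by induction on the Taylor coefficients (clearing
denominators to a bivariate polynomial over the complex algebraic numbers, `P = tᵃ P₁` with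
`P₁(0, ·) ≠ 0` giving `Φ 0 ∈ ℚ̄`, then `Φ = Φ 0 + t · dslope Φ 0` and `P₁(t, Φ 0 + tY)`), and
`LogTaylorCoeffsAlgebraic` proves (2) from (1) applied to `Ψ = e^{ℓ}` (with `N = 0`), the Leibniz
closure of jets with algebraic entries, the inverse of a unit, and `ℓ' = Ψ'/Ψ`. This file states
the stub verbatim as their conjunction.
-/

namespace Summit.Schanuel.Schanuel.Cruxes.SparsityTwo.CuspGermSchneiderSparsity

open Filter Topology Complex Polynomial Literature.NumberTheory.Transcendental
open scoped Real

/-- **stub_taylorLogCoeffsAlgebraic** (ANF). (1) If `Φ` is analytic at `0` and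
`R(t⁻ᵉ, Φ(t)/t^N) = 0` on a punctured neighbourhood of `0` for a non-zero `R ∈ ℂ[X, Y]` with ALGEBRAIC coefficients
(`e ≥ 1`), then every Taylor coefficient of `Φ` at `0` is algebraic. (2) If `ℓ` is analytic at `0` and the UNIT
`e^{ℓ}` satisfies such a relation, then `e^{ℓ 0} ∈ ℚ̄` and the coefficients of `ℓ` of positive order are
algebraic. -/
theorem stub_taylorLogCoeffsAlgebraic :
    (∀ (Φ : ℂ → ℂ) (e N : ℕ) (R : MvPolynomial (Fin 2) ℂ), 0 < e → AnalyticAt ℂ Φ 0 → R ≠ 0 →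
        (∀ m, IsAlgebraic ℚ (R.coeff m)) →
        (∀ᶠ t in 𝓝[≠] (0 : ℂ), MvPolynomial.eval ![(t ^ e)⁻¹, Φ t / t ^ N] R = 0) →
        ∀ n : ℕ, IsAlgebraic ℚ (iteratedDeriv n Φ 0)) ∧
    (∀ (ℓ : ℂ → ℂ) (e : ℕ) (R : MvPolynomial (Fin 2) ℂ), 0 < e → AnalyticAt ℂ ℓ 0 → R ≠ 0 →
        (∀ m, IsAlgebraic ℚ (R.coeff m)) →
        (∀ᶠ t in 𝓝[≠] (0 : ℂ), MvPolynomial.eval ![(t ^ e)⁻¹, Complex.exp (ℓ t)] R = 0) →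
        IsAlgebraic ℚ (Complex.exp (ℓ 0)) ∧ ∀ n : ℕ, 0 < n → IsAlgebraic ℚ (iteratedDeriv n ℓ 0)) :=
  ⟨fun Φ e N R he hΦ hR halg h =>
      isAlgebraic_iteratedDeriv_of_mvPolynomial_relation Φ e N R he hΦ hR halg h,
    fun ℓ e R he hℓ hR halg h =>
      isAlgebraic_exp_and_iteratedDeriv_of_mvPolynomial_exp_relation ℓ e R he hℓ hR halg h⟩

end Summit.Schanuel.Schanuel.Cruxes.SparsityTwo.CuspGermSchneiderSparsity
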